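import Summits.QuantumFields.YangMills.Theorems.PoincareLipschitzSobolevCellAverages
import Literature.Analysis.FunctionSpaces.SobolevDifferenceQuotients
import HarnessLib

/-!
# LINE 25 «compactness_transfer» (stmt-QuantumFields-23533), S2♭″ brick (Γ5a) «SOBOLEV CELL-AVERAGE ROWS», FILE C —
# (a-ii) THE TRANSLATION ROW: `‖R³•∫_{cell_{y+e_μ}} V − R³•∫_{cell_y} V‖² ≤ R·‖GV·e_μ‖²_{L²(two-cell box)}` for a Sobolev map

Cell `ym3-torus` (YM ladder rung R3 — a RUNG, NOT the Clay problem: not d = 4, not infinite volume, not a mass gap); WIDTH COPY «width 15» of ym3-torus-p1,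
gen 6; helper `--supports stmt-QuantumFields-23533`.  THEOREMS ONLY (0 `def`, default heartbeats).  Letters: w7's open grid cell
`{x | ∀ i, (y i : ℝ)∕R < x i ∧ x i < ((y i : ℝ)+1)∕R}`, lit `B4Eq19LatticeOperators.unitVec`, `EuclideanSpace.single μ 1`, lit `diffQuot`,
`MemSobolevDomain` ∕ `HasWeakFDerivOn`.

WHY (LEAD w1 g10 12:29:32Z S2♭″ ARCHITECTURE v0, (Γ5a) → px15, row (a-ii) «`‖a_R(y+e_μ) − a_R y‖² ≤ R·∫_{cell_y ∪ cell_{y+e_μ}} ‖GV x e_μ‖²`»).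
The cell averages `a_R y = R³•∫_{cell_y} V` of a `W^{1,2}` competitor have lattice gradients paid by the continuum gradient: translate `cell_{y+e_μ} = cell_y + R⁻¹e_μ`
(Lebesgue measure is translation invariant), so `a_R(y+e_μ) − a_R y = R²•∫_{cell_y} D^{1∕R}_{e_μ}V`; Cauchy–Schwarz on the cell (volume `R⁻³`) and Evans
§5.8.2 Thm 3 (i) (lit ✓`eLpNorm_diffQuot_le`: `‖D^t_v V‖_{L²(cell)} ≤ ‖GV·v‖_{L²(B)}` when the segments stay in `B`) on the OPEN TWO-CELL BOX
`B = Π_{i≠μ}(yᵢ∕R,(yᵢ+1)∕R) × (y_μ∕R,(y_μ+2)∕R)` (= `cell_y ∪ cell_{y+e_μ}` up to a null face).  CONTENTS: §1 `isOpen_twoCell`, `cell_subset_twoCell`,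
`cell_succ_subset_twoCell`, `segment_mem_twoCell`, `preimage_translate_cell` (`(· + R⁻¹e_μ)⁻¹' cell_{y+e_μ} = cell_y`), `volume_twoCell_lt_top`,
★`setIntegral_cell_succ_eq` (`∫_{cell_{y+e_μ}} V = ∫_{cell_y} V(· + R⁻¹e_μ)`); §2 `enorm_setIntegral_sq_le` (Cauchy–Schwarz `‖∫_s w‖ₑ² ≤ μ(s)·‖w‖²_{L²(s)}`),
★★`enorm_sub_smul_setIntegral_sq_le_abstract` (abstract sets `cell, cell′ ⊆ B`, any `κ`, `t`, `v`: `‖κ•∫_{cell′}V − κ•∫_{cell}V‖ₑ² ≤ ofReal(κ²t²·vol(cell))·‖GV·v‖²_{L²(B)}`),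
★★`enorm_sub_smul_setIntegral_cell_sq_le` — (a-ii) in the cell letters with `κ = R³`, `t = R⁻¹`, `v = e_μ`: `… ≤ ofReal R · eLpNorm (GV·e_μ) 2 (vol|B)²`.
The consumer feeds `MemSobolevDomain 1 2 ⟨B⟩ V` ∕ `HasWeakFDerivOn ⟨B⟩ V GV` from the cube data by FILE B's ★`memSobolevDomain_one_two_of_bound` ∕ `hasWeakFDerivOn_mono`
(`B ⊆ Q` once both cells are inside).  NOT here: (a-iv) the tiling sum over `Q_s` (next), (Γ5b)∕(Γ5) (w7).  HONEST SCOPE: NOTHING here proves Γ5, S2♭″, the organ,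
`BlockLipschitzL`, `HistoryTailL`, or any summit statement; YM₃ on T³ is rung R3, not Clay. [cite: Evans2010, §5.8.2 Theorem 3 (i)]
-/

noncomputable section

open MeasureTheory Set Function Filter TopologicalSpace Metric Module
open scoped NNReal ENNReal Topology

namespace Summit.QuantumFields.YangMills.Theorems.PoincareLipschitzSobolevCellTranslation

open Literature.Analysis.FunctionSpaces
open Literature.MathematicalPhysics.QuantumFieldTheory.Balaban1983to89
open B4Eq19LatticeOperators (Zd unitVec)
open Summit.QuantumFields.YangMills.Theorems.PoincareLipschitzSobolevCellAverages

/-! ## §1 The two-cell open box and the translated cell -/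

/-- The open two-cell box `Π_{i≠μ} (yᵢ∕R, (yᵢ+1)∕R) × (y_μ∕R, (y_μ+2)∕R)` is open. [folklore] -/
theorem isOpen_twoCell (R : ℕ) (y : Zd 3) (μ : Fin 3) :
    IsOpen {x : EuclideanSpace ℝ (Fin 3) | ∀ i, (y i : ℝ) / R < x i ∧
      x i < ((y i : ℝ) + (if i = μ then 2 else 1)) / R} := by
  have h : {x : EuclideanSpace ℝ (Fin 3) | ∀ i, (y i : ℝ) / R < x i ∧
      x i < ((y i : ℝ) + (if i = μ then 2 else 1)) / R} =
      ⋂ i : Fin 3, {x | (y i : ℝ) / R < x i ∧ x i < ((y i : ℝ) + (if i = μ then 2 else 1)) / R} := by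
    ext x; simp
  rw [h]
  exact isOpen_iInter_of_finite fun i =>
    (isOpen_lt continuous_const (EuclideanSpace.proj i).continuous).inter
      (isOpen_lt (EuclideanSpace.proj i).continuous continuous_const)

/-- The cell `cell_y` lies in the two-cell box. [folklore] -/
theorem cell_subset_twoCell {R : ℕ} (hR : 0 < R) (y : Zd 3) (μ : Fin 3) :
    {x : EuclideanSpace ℝ (Fin 3) | ∀ i, (y i : ℝ) / R < x i ∧ x i < ((y i : ℝ) + 1) / R} ⊆
      {x : EuclideanSpace ℝ (Fin 3) | ∀ i, (y i : ℝ) / R < x i ∧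
        x i < ((y i : ℝ) + (if i = μ then 2 else 1)) / R} := by
  have hR0 : (0 : ℝ) < R := by exact_mod_cast hR
  intro x hx i
  refine ⟨(hx i).1, (hx i).2.trans_le ?_⟩
  gcongr
  split_ifs <;> norm_num

/-- The segments `x + s·R⁻¹e_μ`, `s ∈ [0,1]`, from a point of `cell_y` stay in the two-cell box.
[folklore] -/
theorem segment_mem_twoCell {R : ℕ} (hR : 0 < R) (y : Zd 3) (μ : Fin 3)
    {x : EuclideanSpace ℝ (Fin 3)}
    (hx : x ∈ {x : EuclideanSpace ℝ (Fin 3) | ∀ i, (y i : ℝ) / R < x i ∧ x i < ((y i : ℝ) + 1) / R})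
    {s : ℝ} (hs : s ∈ Icc (0 : ℝ) 1) :
    x + (s * (R : ℝ)⁻¹) • EuclideanSpace.single μ (1 : ℝ) ∈
      {x : EuclideanSpace ℝ (Fin 3) | ∀ i, (y i : ℝ) / R < x i ∧
        x i < ((y i : ℝ) + (if i = μ then 2 else 1)) / R} := by
  have hR0 : (0 : ℝ) < R := by exact_mod_cast hR
  intro i
  obtain ⟨ha, hb⟩ := hx i
  by_cases hi : i = μ
  · subst hi
    have h1 : (x + (s * (R : ℝ)⁻¹) • EuclideanSpace.single i (1 : ℝ)) i = x i + s * (R : ℝ)⁻¹ := by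
      simp
    rw [h1, if_pos rfl]
    constructor
    · nlinarith [hs.1, inv_pos.2 hR0]
    · have e : ((y i : ℝ) + 2) / R = ((y i : ℝ) + 1) / R + (R : ℝ)⁻¹ := by ring
      rw [e]
      have : s * (R : ℝ)⁻¹ ≤ (R : ℝ)⁻¹ := by nlinarith [hs.2, inv_pos.2 hR0]
      linarith
  · have h1 : (x + (s * (R : ℝ)⁻¹) • EuclideanSpace.single μ (1 : ℝ)) i = x i := by
      simp [hi]
    rw [h1, if_neg hi]
    exact ⟨ha, hb⟩

/-- The translated cell: `x + R⁻¹e_μ ∈ cell_{y+e_μ} ↔ x ∈ cell_y`, as a preimage identity.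
[folklore] -/
theorem preimage_translate_cell {R : ℕ} (hR : 0 < R) (y : Zd 3) (μ : Fin 3) :
    (fun x : EuclideanSpace ℝ (Fin 3) => x + ((R : ℝ)⁻¹) • EuclideanSpace.single μ (1 : ℝ)) ⁻¹'
        {x : EuclideanSpace ℝ (Fin 3) | ∀ i, ((y + unitVec μ) i : ℝ) / R < x i ∧
          x i < (((y + unitVec μ) i : ℝ) + 1) / R} =
      {x : EuclideanSpace ℝ (Fin 3) | ∀ i, (y i : ℝ) / R < x i ∧ x i < ((y i : ℝ) + 1) / R} := by
  have hR0 : (0 : ℝ) < R := by exact_mod_cast hR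
  ext x
  simp only [Set.mem_preimage, Set.mem_setOf_eq]
  refine forall_congr' fun i => ?_
  by_cases hi : i = μ
  · subst hi
    have h1 : (x + ((R : ℝ)⁻¹) • EuclideanSpace.single i (1 : ℝ)) i = x i + (R : ℝ)⁻¹ := by simp
    have h2 : ((y + unitVec i) i : ℝ) = (y i : ℝ) + 1 := by simp [B4Eq19LatticeOperators.unitVec]
    rw [h1, h2]
    have e1 : ((y i : ℝ) + 1) / R = (y i : ℝ) / R + (R : ℝ)⁻¹ := by ring
    have e2 : ((y i : ℝ) + 1 + 1) / R = ((y i : ℝ) + 1) / R + (R : ℝ)⁻¹ := by ring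
    rw [e2, e1]
    constructor
    · rintro ⟨ha, hb⟩; constructor <;> linarith
    · rintro ⟨ha, hb⟩; constructor <;> linarith
  · have h1 : (x + ((R : ℝ)⁻¹) • EuclideanSpace.single μ (1 : ℝ)) i = x i := by simp [hi]
    have h2 : ((y + unitVec μ) i : ℝ) = (y i : ℝ) := by simp [B4Eq19LatticeOperators.unitVec, hi]
    rw [h1, h2]

/-- The next cell `cell_{y+e_μ}` lies in the two-cell box. [folklore] -/
theorem cell_succ_subset_twoCell {R : ℕ} (hR : 0 < R) (y : Zd 3) (μ : Fin 3) :
    {x : EuclideanSpace ℝ (Fin 3) | ∀ i, ((y + unitVec μ) i : ℝ) / R < x i ∧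
        x i < (((y + unitVec μ) i : ℝ) + 1) / R} ⊆
      {x : EuclideanSpace ℝ (Fin 3) | ∀ i, (y i : ℝ) / R < x i ∧
        x i < ((y i : ℝ) + (if i = μ then 2 else 1)) / R} := by
  have hR0 : (0 : ℝ) < R := by exact_mod_cast hR
  intro x hx i
  obtain ⟨ha, hb⟩ := hx i
  have h2 : ((y + unitVec μ) i : ℝ) = (y i : ℝ) + (if i = μ then 1 else 0) := by
    by_cases hi : i = μ
    · subst hi; simp [B4Eq19LatticeOperators.unitVec]
    · simp [B4Eq19LatticeOperators.unitVec, hi]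
  rw [h2] at ha hb
  by_cases hi : i = μ
  · simp only [hi, if_true] at ha hb ⊢
    constructor
    · have : (y μ : ℝ) / R ≤ ((y μ : ℝ) + 1) / R := by gcongr; linarith
      linarith
    · have : ((y μ : ℝ) + 1 + 1) / R = ((y μ : ℝ) + 2) / R := by ring
      linarith
  · simp only [hi, if_false, add_zero] at ha hb ⊢
    exact ⟨ha, hb⟩

/-- The two-cell box has finite volume. [folklore] -/
theorem volume_twoCell_lt_top (R : ℕ) (y : Zd 3) (μ : Fin 3) :
    volume {x : EuclideanSpace ℝ (Fin 3) | ∀ i, (y i : ℝ) / R < x i ∧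
        x i < ((y i : ℝ) + (if i = μ then 2 else 1)) / R} < ∞ := by
  have h : {x : EuclideanSpace ℝ (Fin 3) | ∀ i, (y i : ℝ) / R < x i ∧
      x i < ((y i : ℝ) + (if i = μ then 2 else 1)) / R} =
      (WithLp.ofLp : EuclideanSpace ℝ (Fin 3) → (Fin 3 → ℝ)) ⁻¹'
        (Set.pi univ fun i => Ioo ((y i : ℝ) / R) (((y i : ℝ) + (if i = μ then 2 else 1)) / R)) := by
    ext x; simp [Set.mem_pi]
  rw [h, (PiLp.volume_preserving_ofLp (Fin 3)).measure_preimage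
    (MeasurableSet.univ_pi fun i => measurableSet_Ioo).nullMeasurableSet, Real.volume_pi_Ioo]
  exact ENNReal.prod_lt_top fun i _ => ENNReal.ofReal_lt_top

/-- ★ **Translating the cell integral**: `∫_{cell_{y+e_μ}} V = ∫_{cell_y} V(x + R⁻¹e_μ) dx` (Lebesgue
measure is translation invariant; `MeasurePreserving.setIntegral_preimage_emb`). [folklore] -/
theorem setIntegral_cell_succ_eq {R : ℕ} (hR : 0 < R) (y : Zd 3) (μ : Fin 3)
    (V : EuclideanSpace ℝ (Fin 3) → EuclideanSpace ℝ (Fin 4)) :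
    ∫ x in {x : EuclideanSpace ℝ (Fin 3) | ∀ i, ((y + unitVec μ) i : ℝ) / R < x i ∧
        x i < (((y + unitVec μ) i : ℝ) + 1) / R}, V x =
      ∫ x in {x : EuclideanSpace ℝ (Fin 3) | ∀ i, (y i : ℝ) / R < x i ∧ x i < ((y i : ℝ) + 1) / R},
        V (x + ((R : ℝ)⁻¹) • EuclideanSpace.single μ (1 : ℝ)) := by
  have hmp : MeasurePreserving
      (fun x : EuclideanSpace ℝ (Fin 3) => x + ((R : ℝ)⁻¹) • EuclideanSpace.single μ (1 : ℝ))
      volume volume := measurePreserving_add_right volume _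
  have hme : MeasurableEmbedding
      (fun x : EuclideanSpace ℝ (Fin 3) => x + ((R : ℝ)⁻¹) • EuclideanSpace.single μ (1 : ℝ)) :=
    (Homeomorph.addRight (((R : ℝ)⁻¹) • EuclideanSpace.single μ (1 : ℝ))).measurableEmbedding
  have h := hmp.setIntegral_preimage_emb hme V
    {x : EuclideanSpace ℝ (Fin 3) | ∀ i, ((y + unitVec μ) i : ℝ) / R < x i ∧
        x i < (((y + unitVec μ) i : ℝ) + 1) / R}
  rw [preimage_translate_cell hR y μ] at h
  exact h.symm

/-! ## §2 (a-ii) The translation row of the cell averages -/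

/-- Cauchy–Schwarz for a Bochner integral over a set, in `ℝ≥0∞` currency:
`‖∫_s w‖ₑ² ≤ μ(s) · (eLpNorm w 2 (μ|s))²`. [folklore] -/
theorem enorm_setIntegral_sq_le {X : Type*} [MeasurableSpace X] {ν : Measure X}
    {G : Type*} [NormedAddCommGroup G] [NormedSpace ℝ G] {s : Set X}
    (w : X → G) (hw : AEStronglyMeasurable w (ν.restrict s)) :
    ‖∫ x in s, w x ∂ν‖ₑ ^ 2 ≤ ν s * eLpNorm w 2 (ν.restrict s) ^ 2 := by
  have hmeas : AEMeasurable (fun x => ‖w x‖ₑ) (ν.restrict s) := hw.enorm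
  have hCS : ∫⁻ x in s, ‖w x‖ₑ ∂ν ≤
      (∫⁻ x in s, ‖w x‖ₑ ^ 2 ∂ν) ^ (1 / 2 : ℝ) * (ν s) ^ (1 / 2 : ℝ) := by
    have h := ENNReal.lintegral_mul_le_Lp_mul_Lq (ν.restrict s) Real.HolderConjugate.two_two
      hmeas aemeasurable_const (g := fun _ => 1)
    simp only [Pi.mul_apply, mul_one, lintegral_const, Measure.restrict_apply,
      MeasurableSet.univ, univ_inter, ENNReal.rpow_ofNat] at h
    simpa [one_div] using h
  have h2 : eLpNorm w 2 (ν.restrict s) = (∫⁻ x in s, ‖w x‖ₑ ^ 2 ∂ν) ^ (1 / 2 : ℝ) := by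
    rw [eLpNorm_eq_lintegral_rpow_enorm_toReal two_ne_zero ENNReal.ofNat_ne_top, ENNReal.toReal_ofNat]
    simp only [ENNReal.rpow_ofNat, one_div]
  calc ‖∫ x in s, w x ∂ν‖ₑ ^ 2 ≤ (∫⁻ x in s, ‖w x‖ₑ ∂ν) ^ 2 := by
        gcongr; exact enorm_integral_le_lintegral_enorm _
    _ ≤ ((∫⁻ x in s, ‖w x‖ₑ ^ 2 ∂ν) ^ (1 / 2 : ℝ) * (ν s) ^ (1 / 2 : ℝ)) ^ 2 := by gcongr
    _ = ν s * eLpNorm w 2 (ν.restrict s) ^ 2 := by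
        rw [h2, mul_pow, ← ENNReal.rpow_natCast ((ν s) ^ (1 / 2 : ℝ)), ← ENNReal.rpow_mul]
        norm_num
        rw [mul_comm]

/-- ★★ **(a-ii) THE TRANSLATION ROW — abstract sets.** Let `B ⊇ cell, cell′` be open sets of
`ℝ³` with `cell′ = cell + t·v` (as `(· + t•v)⁻¹' cell′ = cell`), `volume B < ∞`,
`volume cell = ofReal c`, and all segments `x + s·t·v` (`x ∈ cell`, `s ∈ [0,1]`) inside `B`. For
`V ∈ W^{1,2}(B)` with weak derivative `GV` and any real `κ`:
`‖κ•∫_{cell′} V − κ•∫_{cell} V‖ₑ² ≤ ofReal (κ² t² c) · ‖GV·v‖²_{L²(B)}`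
(translate, difference quotient, Cauchy–Schwarz on the cell, lit ✓`eLpNorm_diffQuot_le`).
[cite: Evans2010, §5.8.2 Theorem 3 (i)] -/
theorem enorm_sub_smul_setIntegral_sq_le_abstract {B cell cell' : Set (EuclideanSpace ℝ (Fin 3))}
    (hBo : IsOpen B) (hcello : IsOpen cell) (hsub : cell ⊆ B) (hsub' : cell' ⊆ B)
    (hBfin : volume B < ∞) {c : ℝ} (hvol : volume cell = ENNReal.ofReal c)
    {t : ℝ} (ht : t ≠ 0) (v : EuclideanSpace ℝ (Fin 3))
    (hpre : (fun x : EuclideanSpace ℝ (Fin 3) => x + t • v) ⁻¹' cell' = cell)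
    (hseg : ∀ x ∈ cell, ∀ s ∈ Icc (0 : ℝ) 1, x + (s * t) • v ∈ B)
    (V : EuclideanSpace ℝ (Fin 3) → EuclideanSpace ℝ (Fin 4))
    (GV : EuclideanSpace ℝ (Fin 3) → EuclideanSpace ℝ (Fin 3) →L[ℝ] EuclideanSpace ℝ (Fin 4))
    (hV : MemSobolevDomain 1 2 (⟨B, hBo⟩ : Opens _) volume V)
    (hGV : HasWeakFDerivOn (⟨B, hBo⟩ : Opens _) volume V GV) (κ : ℝ) :
    ‖κ • (∫ x in cell', V x) - κ • (∫ x in cell, V x)‖ₑ ^ 2 ≤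
      ENNReal.ofReal (κ ^ 2 * t ^ 2 * c) * eLpNorm (fun x => GV x v) 2 (volume.restrict B) ^ 2 := by
  -- integrability of `V` on the box and its two cells
  haveI : IsFiniteMeasure (volume.restrict B) := isFiniteMeasure_restrict.2 hBfin.ne
  have hVint : IntegrableOn V B volume := hV.memLp.integrable (by norm_num)
  have hI1 : IntegrableOn V cell volume := hVint.mono_set hsub
  have hmp : MeasurePreserving (fun x : EuclideanSpace ℝ (Fin 3) => x + t • v) volume volume :=
    measurePreserving_add_right volume _
  have hme : MeasurableEmbedding (fun x : EuclideanSpace ℝ (Fin 3) => x + t • v) :=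
    (Homeomorph.addRight (t • v)).measurableEmbedding
  have hI2 : IntegrableOn (fun x => V (x + t • v)) cell volume := by
    have h3 : IntegrableOn V cell' volume := hVint.mono_set hsub'
    have h4 := (hmp.integrableOn_comp_preimage hme).2 h3
    rw [hpre] at h4
    exact h4
  -- translate the second cell and write the difference as `(κ t) • ∫_{cell} D^t_v V`
  have htrans : ∫ x in cell', V x = ∫ x in cell, V (x + t • v) := by
    have h := hmp.setIntegral_preimage_emb hme V cell'
    rw [hpre] at h
    exact h.symm
  have hq : ∀ x, V (x + t • v) - V x = t • diffQuot v t V x := fun x => by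
    rw [diffQuot_apply, smul_smul, mul_inv_cancel₀ ht, one_smul]
  have hdiff : κ • (∫ x in cell', V x) - κ • (∫ x in cell, V x) =
      (κ * t) • ∫ x in cell, diffQuot v t V x := by
    calc κ • (∫ x in cell', V x) - κ • (∫ x in cell, V x)
        = κ • (∫ x in cell, V (x + t • v)) - κ • (∫ x in cell, V x) := by rw [htrans]
      _ = κ • ∫ x in cell, (V (x + t • v) - V x) := by rw [integral_sub hI2 hI1, smul_sub]
      _ = κ • ∫ x in cell, t • diffQuot v t V x := by simp_rw [hq]
      _ = (κ * t) • ∫ x in cell, diffQuot v t V x := by rw [integral_smul, smul_smul]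
  -- Evans §5.8.2 Thm 3 (i) on the box
  have hdq : eLpNorm (diffQuot v t V) 2 (volume.restrict cell) ≤
      eLpNorm (fun x => GV x v) 2 (volume.restrict B) :=
    eLpNorm_diffQuot_le volume (Ω := ⟨B, hBo⟩) (Ω' := ⟨cell, hcello⟩)
      (p := 2) (by norm_num) ENNReal.ofNat_ne_top hV hGV hseg
  -- Cauchy–Schwarz on the cell
  have hmeas : AEStronglyMeasurable (diffQuot v t V) (volume.restrict cell) := by
    have : diffQuot v t V = t⁻¹ • ((fun x => V (x + t • v)) - V) := by
      funext x; simp [diffQuot_apply]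
    rw [this]
    exact (hI2.sub hI1).aestronglyMeasurable.const_smul _
  have hCS := enorm_setIntegral_sq_le (ν := volume) (diffQuot v t V) hmeas
  rw [hvol] at hCS
  -- assemble
  rw [hdiff, enorm_smul, mul_pow, Real.enorm_eq_ofReal_abs, ← ENNReal.ofReal_pow (abs_nonneg _),
    sq_abs]
  calc ENNReal.ofReal ((κ * t) ^ 2) * ‖∫ x in cell, diffQuot v t V x‖ₑ ^ 2
      ≤ ENNReal.ofReal ((κ * t) ^ 2) * (ENNReal.ofReal c *
          eLpNorm (diffQuot v t V) 2 (volume.restrict cell) ^ 2) := by gcongr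
    _ ≤ ENNReal.ofReal ((κ * t) ^ 2) * (ENNReal.ofReal c *
          eLpNorm (fun x => GV x v) 2 (volume.restrict B) ^ 2) := by gcongr
    _ = ENNReal.ofReal (κ ^ 2 * t ^ 2 * c) * eLpNorm (fun x => GV x v) 2 (volume.restrict B) ^ 2 := by
        rw [← mul_assoc, ← ENNReal.ofReal_mul (by positivity)]
        ring_nf

/-- ★★ **(a-ii) THE TRANSLATION ROW OF THE CELL AVERAGES** (`ℝ≥0∞` currency, cell letters): for
`V ∈ W^{1,2}` on the open two-cell box `B = Π_{i≠μ}(yᵢ∕R,(yᵢ+1)∕R) × (y_μ∕R,(y_μ+2)∕R)` with weak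
derivative `GV` there,
`‖R³•∫_{cell_{y+e_μ}} V − R³•∫_{cell_y} V‖ₑ² ≤ R · ‖GV·e_μ‖²_{L²(B)}`. [cite: Evans2010, §5.8.2 Theorem 3 (i)] -/
theorem enorm_sub_smul_setIntegral_cell_sq_le {R : ℕ} (hR : 0 < R) (y : Zd 3) (μ : Fin 3)
    (V : EuclideanSpace ℝ (Fin 3) → EuclideanSpace ℝ (Fin 4))
    (GV : EuclideanSpace ℝ (Fin 3) → EuclideanSpace ℝ (Fin 3) →L[ℝ] EuclideanSpace ℝ (Fin 4))
    (hV : MemSobolevDomain 1 2 (⟨{x : EuclideanSpace ℝ (Fin 3) | ∀ i, (y i : ℝ) / R < x i ∧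
        x i < ((y i : ℝ) + (if i = μ then 2 else 1)) / R}, isOpen_twoCell R y μ⟩ : Opens _) volume V)
    (hGV : HasWeakFDerivOn (⟨{x : EuclideanSpace ℝ (Fin 3) | ∀ i, (y i : ℝ) / R < x i ∧
        x i < ((y i : ℝ) + (if i = μ then 2 else 1)) / R}, isOpen_twoCell R y μ⟩ : Opens _) volume V GV) :
    ‖((R : ℝ) ^ 3) • (∫ x in {x : EuclideanSpace ℝ (Fin 3) | ∀ i, ((y + unitVec μ) i : ℝ) / R < x i ∧
          x i < (((y + unitVec μ) i : ℝ) + 1) / R}, V x) -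
        ((R : ℝ) ^ 3) • (∫ x in {x : EuclideanSpace ℝ (Fin 3) | ∀ i, (y i : ℝ) / R < x i ∧
          x i < ((y i : ℝ) + 1) / R}, V x)‖ₑ ^ 2 ≤
      ENNReal.ofReal (R : ℝ) * eLpNorm (fun x => GV x (EuclideanSpace.single μ (1 : ℝ))) 2
        (volume.restrict {x : EuclideanSpace ℝ (Fin 3) | ∀ i, (y i : ℝ) / R < x i ∧
          x i < ((y i : ℝ) + (if i = μ then 2 else 1)) / R}) ^ 2 := by
  have hR0 : (0 : ℝ) < R := by exact_mod_cast hR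
  have h := enorm_sub_smul_setIntegral_sq_le_abstract (isOpen_twoCell R y μ) (isOpen_cell R y)
    (cell_subset_twoCell hR y μ) (cell_succ_subset_twoCell hR y μ) (volume_twoCell_lt_top R y μ)
    (c := ((R : ℝ)⁻¹) ^ 3) (volume_cell hR y) (t := (R : ℝ)⁻¹) (inv_ne_zero hR0.ne')
    (EuclideanSpace.single μ (1 : ℝ)) (preimage_translate_cell hR y μ)
    (fun x hx s hs => segment_mem_twoCell hR y μ hx hs) V GV hV hGV ((R : ℝ) ^ 3)
  have e : ((R : ℝ) ^ 3) ^ 2 * ((R : ℝ)⁻¹) ^ 2 * ((R : ℝ)⁻¹) ^ 3 = R := by field_simp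
  rw [e] at h
  exact h

end Summit.QuantumFields.YangMills.Theorems.PoincareLipschitzSobolevCellTranslation

end
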